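import Mathlib
import Summits.Schanuel.Schanuel.Theses.RigidCore
import Literature.NumberTheory.Transcendental.ExpVarieties
import Literature.NumberTheory.Transcendental.RoyCriterion
import Literature.ModelTheory.ExponentialFields.Languages

/-! Sketch for crux-ideate stmt-Schanuel-0969 (MinimalCounterexampleInAcl), ideator 3.
First lemmas of the card `generic-fibres-closed-isolation`. Nothing is proved here. -/

noncomputable section

open scoped Topology

namespace Summit.Schanuel.Schanuel.Cruxes.MinimalCounterexampleInAcl.GenericFibresClosedIsolation

open Literature.NumberTheory.Transcendental Literature.ModelTheory.ExponentialFields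

/-- The solution set `S_W^ind` of ℚ-linearly independent graph points on `W ⊆ ℂⁿ × ℂⁿ`. -/
def indepGraphPoints (n : ℕ) (W : Set (Fin n ⊕ Fin n → ℂ)) : Set (Fin n → ℂ) :=
  {x | LinearIndependent ℚ x ∧ Sum.elim x (Complex.exp ∘ x) ∈ W}

/-- FIRST LEMMA (L1, provable now; kills the route's foreseen 'uniform finiteness of dependent
subspaces' glue): for a Zariski-closed `W` defined over the prime field, every coordinate of every
point of `S_W^ind` lies in acl^{ℂ_exp}(∅) as soon as `S_W^ind` is finite — because ℤ (kernel
stabiliser), hence ℚ-linear independence, hence `S_W^ind` itself, is ∅-definable in `Language.expRing`. -/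
def FiniteIndepGraphPointsInAcl : Prop :=
  ∀ (n : ℕ) (W : Set (Fin n ⊕ Fin n → ℂ)), IsDefinedOver (⊥ : Subfield ℂ) W →
    (indepGraphPoints n W).Finite →
    ∀ x ∈ indepGraphPoints n W, ∀ i : Fin n, ∃ s : Set ℂ, s.Finite ∧
      Set.Definable₁ (∅ : Set ℂ) Language.expRing s ∧ x i ∈ s

/-- The definability half alone (L1a): `S_W^ind` is ∅-definable in ℂ_exp (as an `n`-ary relation). -/
def IndepGraphPointsDefinable : Prop :=
  ∀ (n : ℕ) (W : Set (Fin n ⊕ Fin n → ℂ)), IsDefinedOver (⊥ : Subfield ℂ) W →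
    Set.Definable (∅ : Set ℂ) Language.expRing (indepGraphPoints n W)

/-- SECOND LEMMA (L2, provable now from `ax_schanuel_holds` + the crux's own hypothesis SC(r<n)):
at the first failing rank, every ℚ-linearly independent graph point of a prime-field variety of
dimension `< n` is an ISOLATED point of `S_W = {z | (z, e^z) ∈ W}` (positive-dimensional analytic
components consist of ℚ-linearly dependent points: fibre dimension over the ℚ-generic projection). -/
def IndepGraphPointsIsolated : Prop :=
  ∀ (n : ℕ) (W : Set (Fin n ⊕ Fin n → ℂ)), IsDefinedOver (⊥ : Subfield ℂ) W →
    zariskiDim ℂ W < (n : WithBot ℕ∞) → (∀ r < n, SchanuelRank r) →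
    ∀ x ∈ indepGraphPoints n W, ∃ U ∈ 𝓝 x, U ∩ {z : Fin n → ℂ | Sum.elim z (Complex.exp ∘ z) ∈ W} = {x}

/-- THIRD LEMMA (L3, provable now from L2 + local finiteness of irreducible components of analytic
sets): the set of independent graph points is closed and discrete, hence finite iff bounded. -/
def IndepGraphPointsFiniteOfBounded : Prop :=
  ∀ (n : ℕ) (W : Set (Fin n ⊕ Fin n → ℂ)), IsDefinedOver (⊥ : Subfield ℂ) W →
    zariskiDim ℂ W < (n : WithBot ℕ∞) → (∀ r < n, SchanuelRank r) →
    Bornology.IsBounded (indepGraphPoints n W) → (indepGraphPoints n W).Finite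

/-- TRANSFER TARGET C⁺ (END-BOUNDEDNESS, the hard stub): at the first failing rank the independent
graph points of a prime-field variety of dimension `< n` form a bounded set. -/
def EndBoundedness : Prop :=
  ∀ (n : ℕ) (W : Set (Fin n ⊕ Fin n → ℂ)), IsDefinedOver (⊥ : Subfield ℂ) W →
    zariskiDim ℂ W < (n : WithBot ℕ∞) → (∀ r < n, SchanuelRank r) →
    Bornology.IsBounded (indepGraphPoints n W)

/-- LOCUS LEMMA (L0, provable now, Mathlib algebra): if `trdeg ℚ(x, e^x) < n` then `(x, e^x)` lies
on a prime-field-defined Zariski-closed set of dimension `< n` (its ℚ-locus); used to instantiate `W`. -/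
def LocusExists : Prop :=
  ∀ (n : ℕ) (x : Fin n → ℂ),
    Algebra.trdeg ℚ ↥(IntermediateField.adjoin ℚ (Set.range x ∪ Set.range (Complex.exp ∘ x))) < (n : Cardinal) →
    ∃ W : Set (Fin n ⊕ Fin n → ℂ), IsDefinedOver (⊥ : Subfield ℂ) W ∧
      Sum.elim x (Complex.exp ∘ x) ∈ W ∧ zariskiDim ℂ W < (n : WithBot ℕ∞)

/-- COMPOSITION (the shape a crux-plan skeleton would certify): L0 + L1 + L3 + C⁺ ⇒ the crux,
kernel-checked here. -/
theorem crux_of (hL0 : LocusExists) (hL1 : FiniteIndepGraphPointsInAcl)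
    (hL3 : IndepGraphPointsFiniteOfBounded) (hC : EndBoundedness) :
    Summit.Schanuel.Schanuel.Theses.RigidCore.MinimalCounterexampleInAcl := by
  intro n x hx htr hSC i
  obtain ⟨W, hW, hmem, hdim⟩ := hL0 n x htr
  have hfin : (indepGraphPoints n W).Finite := hL3 n W hW hdim hSC (hC n W hW hdim hSC)
  exact hL1 n W hW hfin x ⟨hx, hmem⟩ i

end Summit.Schanuel.Schanuel.Cruxes.MinimalCounterexampleInAcl.GenericFibresClosedIsolation
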